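import Mathlib
import Summits.Ventures.HodgeRepro.Tier4.Target
import Summits.Ventures.HodgeRepro.Tier4.Line3.Defs
import Summits.Ventures.HodgeRepro.Tier4.Line3.DefsLemmas
import Summits.Ventures.HodgeRepro.Tier4.Line3.HeckeEquivarianceLemmas
import Summits.Ventures.HodgeRepro.Tier4.Line3.TorusInvariance
import Summits.Ventures.HodgeRepro.Tier4.Line3.MainClassReps
import Summits.Ventures.HodgeRepro.Tier4.Line3.LocSScalarObstructionGen
import Summits.Ventures.HodgeRepro.Tier4.Line3.UnitCopyScaling

/-!
# Tier4/Line3/UnitCopyTerm — the orbital term at a per-slot scalar copy of a positive orbit: the archimedean phase times a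
non-negative real

Blind re-derivation cell `pub-hodge-repro`, Tier 4 «PROVE THE STEP», LINE L3, seat t4-L3-p2 (g2); bus S13495 (1).  For the repaired
line's family sum (plan-3 g3 S13492 (4)) this module computes the orbital term of the per-slot scalar copy `ε • xm` of an orbit
on which every summand is a non-negative real (what `LocPS.pos` gives on the main orbit, once transported to every line tuple of
the orbit):

* `scaleLine ε w := lines (fun j => ε j • rep w j)` scales a line tuple slot by slot; `scaleLine_lines`, `scaleLine_scaleLine_inv`;
* `fibreEquiv` — for `ε` with non-zero entries, `w ↦ scaleLine ε w` is a bijection from the fibre of `orbitOf (lines xm)` onto the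
  fibre of `orbitOf (lines (ε • xm))` (`exists_unitary_of_orbitOf_eq`, MainClassReps);
* **`term_scaleLine_eq`**: under the per-slot scalar symmetries `SlotScalarSymmetric D j (ε j) (lam j)`, if every summand of the
  orbit of `xm` is a non-negative real (at the level `K` and translate `γ`), then
  `term K γ (orbitOf (lines (ε • xm))) = lam 0 · lam 1 · conj (lam 2 · lam 3) · T` with `T ≥ 0` real — the copy's term is the
  archimedean phase `Λ(ε)` times a non-negative real, and it is a non-negative real exactly when `Λ(ε) ∈ ℝ_{≥ 0}` (or `T = 0`).
  No unfolding over the fundamental domain, no summability, no integrability is used (`Complex.ofReal_tsum`, `integral_ofReal`).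

Nothing here says anything about the status of the Hodge conjecture for CM abelian varieties, which is NOT proved
(HC_CM is NOT proved by anyone in this repository).
-/

set_option autoImplicit false

noncomputable section

namespace Summit.Ventures.HodgeRepro.Tier4.Line3

open Summit.Ventures.HodgeRepro.Tier4
open Matrix NumberField MeasureTheory
open scoped ComplexConjugate

namespace T4Data

variable (X : T4Data)

/-! ### 1. Scaling line tuples slot by slot -/

/-- The per-slot scalar copy of a line tuple: the line tuple of `ε • rep w`. -/
def scaleLine (ε : Fin 4 → X.E) (w : X.LineTuple) : X.LineTuple :=
  X.lines fun j => ε j • X.rep w j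

/-- Scaling commutes with `lines`: `scaleLine ε (lines x) = lines (ε • x)`. -/
theorem scaleLine_lines (ε : Fin 4 → X.E) (x : X.Tuple) :
    X.scaleLine ε (X.lines x) = X.lines fun j => ε j • x j := by
  obtain ⟨t, ht, hrep⟩ := X.exists_torus_rep_lines x
  unfold scaleLine
  rw [hrep]
  have : (fun j => ε j • (fun j => t j • x j) j) = fun j => t j • (ε j • x j) :=
    funext fun j => smul_comm _ _ _
  rw [this, X.lines_smul t ht]

/-- Scaling by `ε` then by `ε⁻¹` is the identity on line tuples (`ε j ≠ 0`). -/
theorem scaleLine_scaleLine_inv (ε : Fin 4 → X.E) (hε : ∀ j, ε j ≠ 0) (w : X.LineTuple) :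
    X.scaleLine (fun j => (ε j)⁻¹) (X.scaleLine ε w) = w := by
  have h1 : X.scaleLine ε w = X.lines (fun j => ε j • X.rep w j) := rfl
  rw [h1, X.scaleLine_lines]
  have : (fun j => (ε j)⁻¹ • ε j • X.rep w j) = X.rep w := by
    funext j
    simp only [smul_smul]
    rw [inv_mul_cancel₀ (hε j), one_smul]
  rw [this, X.lines_rep]

/-- A per-slot scalar copy of a tuple in the orbit of `lines x` lies in the orbit of `lines (ε • x)`. -/
theorem orbitOf_scaleLine (ε : Fin 4 → X.E) (x : X.Tuple) {w : X.LineTuple}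
    (h : X.orbitOf w = X.orbitOf (X.lines x)) :
    X.orbitOf (X.scaleLine ε w) = X.orbitOf (X.lines fun j => ε j • x j) := by
  obtain ⟨g, hg, rfl⟩ := X.exists_unitary_of_orbitOf_eq x h.symm
  rw [X.scaleLine_lines]
  have : (fun j => ε j • g *ᵥ x j) = fun j => g *ᵥ (ε j • x j) := funext fun j => (Matrix.mulVec_smul _ _ _).symm
  rw [this]
  exact (Quot.sound ((X.orbitStepL_lines_iff _ _).2 ⟨g, hg, rfl⟩)).symm

/-- **THE FIBRE BIJECTION**: for `ε` with non-zero entries, scaling identifies the fibre of the orbit of `lines xm` with the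
fibre of the orbit of `lines (ε • xm)`. -/
def fibreEquiv (ε : Fin 4 → X.E) (hε : ∀ j, ε j ≠ 0) (xm : X.Tuple) :
    {w : X.LineTuple // X.orbitOf w = X.orbitOf (X.lines xm)} ≃
      {w : X.LineTuple // X.orbitOf w = X.orbitOf (X.lines fun j => ε j • xm j)} where
  toFun w := ⟨X.scaleLine ε w.1, X.orbitOf_scaleLine ε xm w.2⟩
  invFun w := ⟨X.scaleLine (fun j => (ε j)⁻¹) w.1, by
    have h := X.orbitOf_scaleLine (fun j => (ε j)⁻¹) (fun j => ε j • xm j) w.2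
    have e : (fun j => (ε j)⁻¹ • ε j • xm j) = xm := by
      funext j
      rw [smul_smul, inv_mul_cancel₀ (hε j), one_smul]
    rwa [e] at h⟩
  left_inv w := Subtype.ext (X.scaleLine_scaleLine_inv ε hε w.1)
  right_inv w := Subtype.ext (by
    have hε' : ∀ j, (ε j)⁻¹ ≠ 0 := fun j => inv_ne_zero (hε j)
    have := X.scaleLine_scaleLine_inv (fun j => (ε j)⁻¹) hε' w.1
    simp only [inv_inv] at this
    exact this)

/-! ### 2. The summand and the term at a copy -/

/-- The summand at a scaled line tuple, through the per-slot scalar symmetries. -/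
theorem summand_scaleLine (D : X.ThetaData) {ε : Fin 4 → X.E} {lam : Fin 4 → ℂ}
    (hu : ∀ j, X.SlotScalarSymmetric D j (ε j) (lam j)) {K : X.Level} (γ : X.Tr K) (w : X.LineTuple)
    (z : Fin 2 → ℂ) :
    X.summand D.Φ D.cf γ (X.scaleLine ε w) z =
      lam 0 * lam 1 * conj (lam 2 * lam 3) *
        (((X.gaussRatio ε (X.rep w) * X.kernelScale ε (X.rep w) z : ℝ) : ℂ) * X.summand D.Φ D.cf γ w z) := by
  rw [X.summand_eq_of_lines_eq D.Φ D.cf D.weight γ (w := X.scaleLine ε w) (x := fun j => ε j • X.rep w j) rfl z,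
    X.summand_smul_family D hu γ (X.rep w) z]
  rfl

/-- A complex number with zero imaginary part and non-negative real part is the cast of a non-negative real. -/
theorem exists_nonneg_ofReal {a : ℂ} (h : a.im = 0 ∧ 0 ≤ a.re) : ∃ r : ℝ, 0 ≤ r ∧ a = r :=
  ⟨a.re, h.2, Complex.ext (by simp) (by simp [h.1])⟩

/-- **THE TERM AT A PER-SLOT SCALAR COPY OF A POSITIVE ORBIT** is the archimedean phase `Λ(ε) = lam 0 · lam 1 · conj (lam 2 · lam 3)`
times a non-negative real. -/
theorem term_scaleLine_eq (D : X.ThetaData) {ε : Fin 4 → X.E} (hε : ∀ j, ε j ≠ 0) {lam : Fin 4 → ℂ}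
    (hu : ∀ j, X.SlotScalarSymmetric D j (ε j) (lam j)) (K : X.Level) (γ : X.Tr K) (xm : X.Tuple)
    (hpos : ∀ w : X.LineTuple, X.orbitOf w = X.orbitOf (X.lines xm) → ∀ z : Fin 2 → ℂ,
      (X.summand D.Φ D.cf γ w z).im = 0 ∧ 0 ≤ (X.summand D.Φ D.cf γ w z).re) :
    ∃ T : ℝ, 0 ≤ T ∧
      X.term D.Φ D.cf K γ (X.orbitOf (X.lines fun j => ε j • xm j)) = lam 0 * lam 1 * conj (lam 2 * lam 3) * T := by
  classical
  -- the non-negative real value of each summand of the orbit of `xm`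
  choose r hr0 hr using fun (w : {w : X.LineTuple // X.orbitOf w = X.orbitOf (X.lines xm)}) (z : Fin 2 → ℂ) =>
    exists_nonneg_ofReal (hpos w.1 w.2 z)
  set ρ : {w : X.LineTuple // X.orbitOf w = X.orbitOf (X.lines xm)} → (Fin 2 → ℂ) → ℝ :=
    fun w z => X.gaussRatio ε (X.rep w.1) * X.kernelScale ε (X.rep w.1) z * r w z with hρ
  have hρ0 : ∀ w z, 0 ≤ ρ w z := fun w z =>
    mul_nonneg (X.gaussRatio_mul_kernelScale_nonneg ε (X.rep w.1) z) (hr0 w z)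
  refine ⟨∫ z in X.domain K, ∑' w, ρ w z, integral_nonneg fun z => tsum_nonneg fun w => hρ0 w z, ?_⟩
  unfold T4Data.term
  -- reindex the fibre of the copy through the bijection
  rw [show (fun z => ∑' w : {w : X.LineTuple // X.orbitOf w = X.orbitOf (X.lines fun j => ε j • xm j)},
      X.summand D.Φ D.cf γ w.1 z) = fun z => lam 0 * lam 1 * conj (lam 2 * lam 3) * ((∑' w, ρ w z : ℝ) : ℂ) from ?_]
  · rw [integral_const_mul, integral_complex_ofReal]
  funext z
  rw [← (X.fibreEquiv ε hε xm).tsum_eq, Complex.ofReal_tsum, ← tsum_mul_left]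
  refine tsum_congr fun w => ?_
  show X.summand D.Φ D.cf γ (X.scaleLine ε w.1) z = _
  rw [X.summand_scaleLine D hu γ w.1 z, hr w z, hρ]
  push_cast
  ring

/-- The copy's term is a non-negative real as soon as the phase is: `Λ(ε) = lam 0 · lam 1 · conj (lam 2 · lam 3) ∈ ℝ_{≥ 0}`. -/
theorem term_scaleLine_nonneg (D : X.ThetaData) {ε : Fin 4 → X.E} (hε : ∀ j, ε j ≠ 0) {lam : Fin 4 → ℂ}
    (hu : ∀ j, X.SlotScalarSymmetric D j (ε j) (lam j))
    (hΛ : (lam 0 * lam 1 * conj (lam 2 * lam 3)).im = 0 ∧ 0 ≤ (lam 0 * lam 1 * conj (lam 2 * lam 3)).re)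
    (K : X.Level) (γ : X.Tr K) (xm : X.Tuple)
    (hpos : ∀ w : X.LineTuple, X.orbitOf w = X.orbitOf (X.lines xm) → ∀ z : Fin 2 → ℂ,
      (X.summand D.Φ D.cf γ w z).im = 0 ∧ 0 ≤ (X.summand D.Φ D.cf γ w z).re) :
    (X.term D.Φ D.cf K γ (X.orbitOf (X.lines fun j => ε j • xm j))).im = 0 ∧
      0 ≤ (X.term D.Φ D.cf K γ (X.orbitOf (X.lines fun j => ε j • xm j))).re := by
  obtain ⟨T, hT, hterm⟩ := X.term_scaleLine_eq D hε hu K γ xm hpos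
  obtain ⟨Λ, hΛ0, hΛeq⟩ := exists_nonneg_ofReal hΛ
  rw [hterm, hΛeq, ← Complex.ofReal_mul]
  exact ⟨Complex.ofReal_im _, by rw [Complex.ofReal_re]; exact mul_nonneg hΛ0 hT⟩

/-- **COPIES WITH MATCHED PHASES ARE POSITIVE**: when the slot pairs `(0, 2)` and `(1, 3)` carry the SAME constants
(`lam 2 = lam 0`, `lam 3 = lam 1` — e.g. the symmetric sub-family `ε₂ = ε₀`, `ε₃ = ε₁` when the slot functions `cf 0, cf 2`
and `cf 1, cf 3` have the same archimedean phases), the phase is `|lam 0 · lam 1|² ≥ 0`.  (With CONJUGATE constants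
`lam 2 = conj (lam 0)`, `lam 3 = conj (lam 1)` the phase would be `(lam 0 · lam 1)²`, not a modulus.) -/
theorem term_scaleLine_nonneg_of_eq (D : X.ThetaData) {ε : Fin 4 → X.E} (hε : ∀ j, ε j ≠ 0) {lam : Fin 4 → ℂ}
    (hu : ∀ j, X.SlotScalarSymmetric D j (ε j) (lam j)) (h2 : lam 2 = lam 0) (h3 : lam 3 = lam 1)
    (K : X.Level) (γ : X.Tr K) (xm : X.Tuple)
    (hpos : ∀ w : X.LineTuple, X.orbitOf w = X.orbitOf (X.lines xm) → ∀ z : Fin 2 → ℂ,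
      (X.summand D.Φ D.cf γ w z).im = 0 ∧ 0 ≤ (X.summand D.Φ D.cf γ w z).re) :
    (X.term D.Φ D.cf K γ (X.orbitOf (X.lines fun j => ε j • xm j))).im = 0 ∧
      0 ≤ (X.term D.Φ D.cf K γ (X.orbitOf (X.lines fun j => ε j • xm j))).re := by
  refine X.term_scaleLine_nonneg D hε hu ?_ K γ xm hpos
  rw [h2, h3, Complex.mul_conj]
  exact ⟨Complex.ofReal_im _, by rw [Complex.ofReal_re]; exact Complex.normSq_nonneg _⟩

end T4Data

end Summit.Ventures.HodgeRepro.Tier4.Line3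

end
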